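import Summits.AtomisticToContinuum.BoseEinsteinCondensation.Theorems.BECRieszReverseHolderCoarseGrainedReverseHolderStubPartitionComparison
import Summits.AtomisticToContinuum.BoseEinsteinCondensation.Theorems.BECRieszReverseHolderCoarseGrainedReverseHolderStubSumKlFunLeMulLog
import Summits.AtomisticToContinuum.BoseEinsteinCondensation.Theorems.BECRieszReverseHolderCoarseGrainedReverseHolderStubLintegralOfRealLeOfTangent
import Summits.AtomisticToContinuum.BoseEinsteinCondensation.Theorems.BECRieszReverseHolderCoarseGrainedReverseHolderStubAeOfRealCubeFunctionalEq
import Summits.AtomisticToContinuum.BoseEinsteinCondensation.Theorems.BECCellInformationCellInformationBoundCruxPosition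
import HarnessLib

/-!
# Route `BECRieszReverseHolder`, crux `CoarseGrainedReverseHolder` (stmt-AtomisticToContinuum-12840):
# the crux implies the target and the crux of the sibling route `BECCellInformation`, and is its own small-scale germ

Supports (does not close) stmt-AtomisticToContinuum-12840 (line `registered`, lead c7). The crux bounds,
uniformly in `N = n + 1`, the coarse-grained reverse-Hölder ("Rényi-2") functional
`F_{n,ℓ}(Ψ) = m³ ∫ dY Σ_Q (∫_Q |Ψ(x,Y)|² dx)² / ∫ |Ψ(x,Y)|² dx` (`m = ⌊L/ℓ⌋₊`, cubes `Q` of side `L/m`)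
of non-negative `δ`-near-minimisers of the dilute Dirichlet Bose gas, at EVERY resolution `ℓ > 0`. This
file composes the four landed stubs of the lead-c7 wave (`stub_partitionComparison`,
`stub_sum_klFun_le_mul_log`, `stub_lintegral_ofReal_le_of_tangent`, `stub_ae_ofReal_cubeFunctional_eq`) into:

* `lintegral_coarseCondEntropy_le_of_cubeBound` — FIXED-STATE ESTIMATE: for a trial state `Ψ` and
  `0 < M ≤ m`, a bound `F ≤ C` on the cube functional at the partition into `m³` cubes bounds the coarse
  conditional entropy integrand `∫ dY Σ_k (w(Y)/M³) klFun(M³ A_k(Y)/w(Y))` of route `BECCellInformation`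
  at the partition into `M³` cubes by `log (max (216 C) 1) + 1` (pointwise in `Y`: Shannon deficit
  `Σ_k p_k log(M³ p_k) ≤ log(M³ Σ_k p_k²)`, the Rényi-2 deficit, by Jensen; then Jensen for `log` under
  the probability law `w(Y) dY` by the tangent line; the partition change costs the factor `216`).
* `condEntropyBound_of_coarseGrainedReverseHolder` — **crux ⇒ the TARGET of `BECCellInformation`**:
  `CoarseGrainedReverseHolder → CondEntropyBound` (stmt-12840 ⇒ stmt-13438), through that route's PROVED
  `TwoScaleReduction` (cube log-Sobolev, kinetic energy) and `EnergyPerParticleBound`; cell side `l = 1`,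
  crux resolution `ℓ = 1/2` (so that `⌈L⌉₊ ≤ ⌊2L⌋₊` eventually).
* `cellInformationBound_of_coarseGrainedReverseHolder` — **crux ⇒ the open CRUX of `BECCellInformation`**:
  `CoarseGrainedReverseHolder → CellInformationBound` (stmt-12840 ⇒ stmt-13439), by the landed converse
  glue `cellInformationBound_of_condEntropyBound` of that route. So the reverse-Hölder leaf is at least as
  strong as the conditional-entropy / mutual-information leaf: refuting the latter refutes this crux, and
  the latter is the weaker statement to attack.
* `coarseGrainedReverseHolder_of_smallScales` — **the crux is its own small-scale germ**: if the crux
  bound holds at every resolution `ℓ ≤ ℓ₀(v, ρ)` then it holds at every `ℓ > 0` (constant `216 · max C 0`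
  from resolution `ℓ₀`; coarser partitions are dominated by finer ones, `stub_partitionComparison`).

References: T. M. Cover, J. A. Thomas, *Elements of Information Theory* (2005), Thm 2.7.1 (Jensen /
log-sum); E. H. Lieb, R. Seiringer, J. P. Solovej, J. Yngvason, *The Mathematics of the Bose Gas and its
Condensation* (2005), §1.2 and Ch. 5 (the frame).
-/

noncomputable section

open MeasureTheory Filter Matrix InformationTheory
open scoped ENNReal NNReal BigOperators

namespace Summit.AtomisticToContinuum.BoseEinsteinCondensation.Theorems.CoarseGrainedReverseHolder

open Literature.MathematicalPhysics.QuantumManyBody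
open Literature.MathematicalPhysics.QuantumManyBody.BoseGas
open Summit.AtomisticToContinuum.BoseEinsteinCondensation.Theses.BECRieszReverseHolder
open Summit.AtomisticToContinuum.BoseEinsteinCondensation.Theorems

/-- **Fixed-state estimate (Rényi-2 flatness ⇒ Shannon flatness of the conditional cell law).** For a
trial state `Ψ` of `n+1` bosons in the box of side `L > 0` and `0 < M ≤ m`: if the crux functional at the
partition of `[0,L)³` into `m³` congruent cubes is `≤ ofReal C`, then the coarse conditional entropy
integrand of route `BECCellInformation` at the partition into `M³` cubes — `Σ_k (w(Y)/M³) klFun(M³ A_k(Y)/w(Y))`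
with the real cell masses `A_k(Y) = ∫_{cell k} ‖Ψ(x::Y)‖²` and slice mass `w(Y) = ∫ ‖Ψ(z::Y)‖²` — has
`∫⁻ dY ≤ ofReal (log (max (216 C) 1) + 1)`. Proof: a.e. in `Y`, `Σ_k A_k = w`
(`CoarseChainRule.ae_sum_setIntegral_cell_eq`) and the finite Jensen step `stub_sum_klFun_le_mul_log`
give integrand `≤ w log(g/w)` with `g = M³ Σ_k A_k²/w`; `∫ w = 1`; `∫⁻ ofReal g` is the crux functional at
partition `M` (`stub_ae_ofReal_cubeFunctional_eq`), at most `216 ×` the one at partition `m`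
(`stub_partitionComparison`); conclude with the tangent-line Jensen step
`stub_lintegral_ofReal_le_of_tangent`. [cite: CoverThomas2005, Thm 2.7.1] -/
theorem lintegral_coarseCondEntropy_le_of_cubeBound {n : ℕ} {L : ℝ} (hL : 0 < L) {M m : ℕ}
    (hM : 0 < M) (hMm : M ≤ m) {C : ℝ} (Ψ : TrialState (n + 1) L)
    (hcube : (m : ℝ≥0∞) ^ 3 * ∫⁻ Y : Config n,
        ((∑ k : Fin 3 → Fin m,
            (∫⁻ y in {y : EuclideanSpace ℝ (Fin 3) | ∀ i, y i ∈
                Set.Ico ((k i : ℝ) * (L / m)) (((k i : ℝ) + 1) * (L / m))},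
              (‖Ψ.ψ (Matrix.vecCons y Y)‖₊ : ℝ≥0∞) ^ 2) ^ 2) /
          (∫⁻ y, (‖Ψ.ψ (Matrix.vecCons y Y)‖₊ : ℝ≥0∞) ^ 2)) ≤ ENNReal.ofReal C) :
    ∫⁻ Y : Config n, ENNReal.ofReal (∑ k : Fin 3 → Fin M,
        (∫ z, ‖Ψ.ψ (Matrix.vecCons z Y)‖ ^ 2) / (M : ℝ) ^ 3 *
          klFun ((M : ℝ) ^ 3 * (∫ x in {y : EuclideanSpace ℝ (Fin 3) | ∀ j, y j ∈
              Set.Ico (((k j : ℕ) : ℝ) * (L / (M : ℝ))) ((((k j : ℕ) : ℝ) + 1) * (L / (M : ℝ)))},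
            ‖Ψ.ψ (Matrix.vecCons x Y)‖ ^ 2) / ∫ z, ‖Ψ.ψ (Matrix.vecCons z Y)‖ ^ 2)) ≤
      ENNReal.ofReal (Real.log (max (216 * C) 1) + 1) := by
  -- notation
  set cellM : (Fin 3 → Fin M) → Set (EuclideanSpace ℝ (Fin 3)) := fun k => {y | ∀ j, y j ∈
    Set.Ico (((k j : ℕ) : ℝ) * (L / (M : ℝ))) ((((k j : ℕ) : ℝ) + 1) * (L / (M : ℝ)))} with hcellM
  set w : Config n → ℝ := fun Y => ∫ z, ‖Ψ.ψ (Matrix.vecCons z Y)‖ ^ 2 with hw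
  set A : (Fin 3 → Fin M) → Config n → ℝ := fun k Y => ∫ x in cellM k, ‖Ψ.ψ (Matrix.vecCons x Y)‖ ^ 2
    with hA
  set g : Config n → ℝ := fun Y => (M : ℝ) ^ 3 * (∑ k, A k Y ^ 2) / w Y with hg
  have hMr : (0 : ℝ) < M := Nat.cast_pos.2 hM
  have hKpos : 0 < (M : ℝ) ^ 3 := by positivity
  have hcard : (Fintype.card (Fin 3 → Fin M) : ℝ) = (M : ℝ) ^ 3 := by
    rw [Fintype.card_fun, Fintype.card_fin, Fintype.card_fin, Nat.cast_pow]
  have hw0 : ∀ Y, 0 ≤ w Y := fun Y => integral_nonneg fun z => sq_nonneg _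
  have hA0 : ∀ k Y, 0 ≤ A k Y := fun k Y => integral_nonneg fun x => sq_nonneg _
  have hg0 : ∀ Y, 0 ≤ g Y := fun Y =>
    div_nonneg (mul_nonneg hKpos.le (Finset.sum_nonneg fun k _ => sq_nonneg _)) (hw0 Y)
  -- measurability and integrability in the environment variable
  have hwi : Integrable w := by
    have h := CoarseChainRule.integrable_setIntegral_normSq_vecCons Ψ Set.univ
    simp only [Measure.restrict_univ] at h
    exact h
  have hAi : ∀ k, Integrable (A k) := fun k =>
    CoarseChainRule.integrable_setIntegral_normSq_vecCons Ψ (cellM k)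
  have hgm : AEMeasurable g volume := by
    refine AEMeasurable.div (AEMeasurable.const_mul ?_ _) hwi.aemeasurable
    exact Finset.aemeasurable_fun_sum _ fun k _ => (hAi k).aemeasurable.pow_const 2
  -- `∫ w = 1`
  have hwint : ∫⁻ Y, ENNReal.ofReal (w Y) ≤ 1 := by
    rw [← ofReal_integral_eq_lintegral_ofReal hwi (ae_of_all _ hw0),
      CoarseChainRule.integral_integral_normSq_vecCons Ψ, ENNReal.ofReal_one]
  -- the cube functional at partition `M`, as a real function of `Y`, integrates to at most `216 C`
  have hgint : ∫⁻ Y, ENNReal.ofReal (g Y) ≤ ENNReal.ofReal (216 * C) := by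
    have hid := stub_ae_ofReal_cubeFunctional_eq Ψ M (L / (M : ℝ))
    rw [lintegral_congr_ae hid]
    have hM3 : (M : ℝ≥0∞) ^ 3 ≠ ⊤ := ENNReal.pow_ne_top (ENNReal.natCast_ne_top M)
    have hm3 : (m : ℝ≥0∞) ^ 3 ≠ ⊤ := ENNReal.pow_ne_top (ENNReal.natCast_ne_top m)
    rw [lintegral_const_mul' _ _ hM3]
    calc (M : ℝ≥0∞) ^ 3 * ∫⁻ Y : Config n, (∑ k : Fin 3 → Fin M,
            (∫⁻ x in cellM k, (‖Ψ.ψ (Matrix.vecCons x Y)‖₊ : ℝ≥0∞) ^ 2) ^ 2) /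
              ∫⁻ z, (‖Ψ.ψ (Matrix.vecCons z Y)‖₊ : ℝ≥0∞) ^ 2
        = ∫⁻ Y : Config n, (M : ℝ≥0∞) ^ 3 * ((∑ k : Fin 3 → Fin M,
            (∫⁻ x in cellM k, (‖Ψ.ψ (Matrix.vecCons x Y)‖₊ : ℝ≥0∞) ^ 2) ^ 2) /
              ∫⁻ z, (‖Ψ.ψ (Matrix.vecCons z Y)‖₊ : ℝ≥0∞) ^ 2) := by
          rw [lintegral_const_mul' _ _ hM3]
      _ ≤ ∫⁻ Y : Config n, 216 * ((m : ℝ≥0∞) ^ 3 * ((∑ k : Fin 3 → Fin m,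
            (∫⁻ y in {y : EuclideanSpace ℝ (Fin 3) | ∀ i, y i ∈
                Set.Ico ((k i : ℝ) * (L / m)) (((k i : ℝ) + 1) * (L / m))},
              (‖Ψ.ψ (Matrix.vecCons y Y)‖₊ : ℝ≥0∞) ^ 2) ^ 2) /
              ∫⁻ z, (‖Ψ.ψ (Matrix.vecCons z Y)‖₊ : ℝ≥0∞) ^ 2)) :=
          lintegral_mono fun Y => stub_partitionComparison hL hM hMm _ _
      _ = 216 * ((m : ℝ≥0∞) ^ 3 * ∫⁻ Y : Config n, ((∑ k : Fin 3 → Fin m,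
            (∫⁻ y in {y : EuclideanSpace ℝ (Fin 3) | ∀ i, y i ∈
                Set.Ico ((k i : ℝ) * (L / m)) (((k i : ℝ) + 1) * (L / m))},
              (‖Ψ.ψ (Matrix.vecCons y Y)‖₊ : ℝ≥0∞) ^ 2) ^ 2) /
              ∫⁻ z, (‖Ψ.ψ (Matrix.vecCons z Y)‖₊ : ℝ≥0∞) ^ 2)) := by
          rw [lintegral_const_mul' _ _ (by norm_num), lintegral_const_mul' _ _ hm3]
      _ ≤ 216 * ENNReal.ofReal C := by gcongr
      _ = ENNReal.ofReal (216 * C) := by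
          rw [ENNReal.ofReal_mul (by norm_num), ENNReal.ofReal_ofNat]
  -- the pointwise (a.e.) finite Jensen step
  have hf : ∀ᵐ Y : Config n,
      (0 < w Y → (∑ k, w Y / (M : ℝ) ^ 3 * klFun ((M : ℝ) ^ 3 * A k Y / w Y)) ≤
        w Y * Real.log (g Y / w Y)) ∧
      (w Y = 0 → (∑ k, w Y / (M : ℝ) ^ 3 * klFun ((M : ℝ) ^ 3 * A k Y / w Y)) ≤ 0) := by
    filter_upwards [CoarseChainRule.ae_sum_setIntegral_cell_eq hL hM Ψ] with Y hsum
    refine ⟨fun hwpos => ?_, fun hw0' => ?_⟩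
    · have h := stub_sum_klFun_le_mul_log hcard hKpos (fun k => hA0 k Y) hsum hwpos
      have heq : g Y / w Y = (M : ℝ) ^ 3 * (∑ k, A k Y ^ 2) / w Y ^ 2 := by
        rw [hg]
        field_simp
      rw [heq]
      exact h
    · simp [hw0']
  exact stub_lintegral_ofReal_le_of_tangent (μ := volume) hw0 hg0 hgm hf hwint hgint

/-- **Crux ⇒ the TARGET of route `BECCellInformation`.** `CoarseGrainedReverseHolder → CondEntropyBound`
(stmt-AtomisticToContinuum-12840 ⇒ stmt-AtomisticToContinuum-13438): at cell side `l = 1` the coarse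
conditional entropy of the tagged boson's cell given the environment is at most
`log (max (216 C) 1) + 1`, `C` the crux constant at resolution `ℓ = 1/2` (eventually `⌈L⌉₊ ≤ ⌊2L⌋₊`,
`lintegral_coarseCondEntropy_le_of_cubeBound`), and the PROVED `TwoScaleReduction` +
`EnergyPerParticleBound` of that route upgrade the coarse bound to the full conditional relative entropy
bound `E_Y KL(p(·|Y) ‖ u_Λ) ≤ C'`. [cite: CoverThomas2005, Thm 2.7.1] -/
theorem condEntropyBound_of_coarseGrainedReverseHolder (hC : CoarseGrainedReverseHolder) :
    Summit.AtomisticToContinuum.BoseEinsteinCondensation.Theses.BECCellInformation.CondEntropyBound := by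
  refine TwoScaleReduction.twoScaleReduction_proof energyPerParticleBound_proof ?_
  intro v hv
  obtain ⟨ρ₀, hρ₀, H⟩ := hC v hv
  refine ⟨ρ₀, hρ₀, fun ρ hρ hρlt => ?_⟩
  obtain ⟨C, hev⟩ := H ρ hρ hρlt (1 / 2) (by norm_num)
  refine ⟨1, one_pos, Real.log (max (216 * C) 1) + 1, ?_⟩
  filter_upwards [hev, ((tendsto_sideLength_atTop hρ).comp (tendsto_add_atTop_nat 1)).eventually_ge_atTop
    2] with n hn hLn
  obtain ⟨δ, hδ, hΨ⟩ := hn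
  refine ⟨δ, hδ, fun Ψ hE hpos => ?_⟩
  have hL2 : (2 : ℝ) ≤ sideLength ρ (n + 1) := hLn
  have hL : 0 < sideLength ρ (n + 1) := by linarith
  have hM : 0 < ⌈sideLength ρ (n + 1) / 1⌉₊ := Nat.ceil_pos.2 (by rw [div_one]; exact hL)
  have hMm : ⌈sideLength ρ (n + 1) / 1⌉₊ ≤ ⌊sideLength ρ (n + 1) / (1 / 2)⌋₊ := by
    rw [div_one]
    refine Nat.le_floor ?_
    have h1 : (⌈sideLength ρ (n + 1)⌉₊ : ℝ) < sideLength ρ (n + 1) + 1 := Nat.ceil_lt_add_one hL.le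
    have h2 : sideLength ρ (n + 1) / (1 / 2) = 2 * sideLength ρ (n + 1) := by ring
    rw [h2]
    linarith
  have hcube := hΨ Ψ hE hpos
  dsimp only at hcube
  exact lintegral_coarseCondEntropy_le_of_cubeBound hL hM hMm Ψ hcube

/-- **Crux ⇒ the open crux of route `BECCellInformation`.** `CoarseGrainedReverseHolder →
CellInformationBound` (stmt-AtomisticToContinuum-12840 ⇒ stmt-AtomisticToContinuum-13439), from
`condEntropyBound_of_coarseGrainedReverseHolder` and that route's landed converse glue
`CellInformationBound.cellInformationBound_of_condEntropyBound` (data processing + Gibbs). The Rényi-2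
(reverse-Hölder) positivity leaf is at least as strong as the Shannon (mutual-information) one.
[cite: CoverThomas2005, Thm 2.5.3] -/
theorem cellInformationBound_of_coarseGrainedReverseHolder (hC : CoarseGrainedReverseHolder) :
    Summit.AtomisticToContinuum.BoseEinsteinCondensation.Theses.BECCellInformation.CellInformationBound :=
  CellInformationBound.cellInformationBound_of_condEntropyBound
    (condEntropyBound_of_coarseGrainedReverseHolder hC)

/-- **The crux is its own small-scale germ (resolution monotonicity).** If for every admissible `v` and
all small `ρ` there is `ℓ₀ > 0` such that the crux bound holds at every resolution `0 < ℓ ≤ ℓ₀` (same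
quantifier frame: `∃ C ∀ᶠ n ∃ δ > 0 ∀` non-negative `δ`-near-minimisers), then `CoarseGrainedReverseHolder`
holds at every `ℓ > 0`: for `ℓ > ℓ₀` the partition `⌊L/ℓ⌋₊` is coarser than `⌊L/ℓ₀⌋₊` and the functional
grows by at most the factor `216` (`stub_partitionComparison`, integrated in the environment), so
`C(ℓ) = 216 · max C(ℓ₀) 0` works (eventually `L ≥ ℓ`, so that `⌊L/ℓ⌋₊ ≥ 1`). [folklore] -/
theorem coarseGrainedReverseHolder_of_smallScales
    (h : ∀ v : ℝ → ENNReal, BoseGas.IsRepulsiveFiniteRange v →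
      ∃ ρ₀ : ℝ, 0 < ρ₀ ∧ ∀ ρ : ℝ, 0 < ρ → ρ < ρ₀ → ∃ ℓ₀ : ℝ, 0 < ℓ₀ ∧ ∀ ℓ : ℝ, 0 < ℓ → ℓ ≤ ℓ₀ →
      ∃ C : ℝ, ∀ᶠ n : ℕ in Filter.atTop, ∃ δ : ENNReal, 0 < δ ∧
        ∀ Ψ : TrialState (n + 1) (sideLength ρ (n + 1)),
          energy v Ψ ≤ groundStateEnergy v (n + 1) (sideLength ρ (n + 1)) + δ →
          (∀ X, Ψ.ψ X = (‖Ψ.ψ X‖ : ℂ)) →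
          (⌊sideLength ρ (n + 1) / ℓ⌋₊ : ENNReal) ^ 3 *
              ∫⁻ X : Fin n → EuclideanSpace ℝ (Fin 3),
                ((∑ k : Fin 3 → Fin ⌊sideLength ρ (n + 1) / ℓ⌋₊,
                    (∫⁻ y in {y : EuclideanSpace ℝ (Fin 3) | ∀ i, y i ∈
                        Set.Ico ((k i : ℝ) * (sideLength ρ (n + 1) / ⌊sideLength ρ (n + 1) / ℓ⌋₊))
                          (((k i : ℝ) + 1) * (sideLength ρ (n + 1) / ⌊sideLength ρ (n + 1) / ℓ⌋₊))},
                      (‖Ψ.ψ (Matrix.vecCons y X)‖₊ : ENNReal) ^ 2) ^ 2) /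
                  (∫⁻ y, (‖Ψ.ψ (Matrix.vecCons y X)‖₊ : ENNReal) ^ 2))
            ≤ ENNReal.ofReal C) :
    CoarseGrainedReverseHolder := by
  intro v hv
  obtain ⟨ρ₀, hρ₀, H⟩ := h v hv
  refine ⟨ρ₀, hρ₀, fun ρ hρ hρlt ℓ hℓ => ?_⟩
  obtain ⟨ℓ₀, hℓ₀, Hℓ⟩ := H ρ hρ hρlt
  rcases le_or_gt ℓ ℓ₀ with hle | hgt
  · -- small scales: the hypothesis verbatim
    obtain ⟨C, hev⟩ := Hℓ ℓ hℓ hle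
    refine ⟨C, ?_⟩
    filter_upwards [hev] with n hn
    obtain ⟨δ, hδ, hΨ⟩ := hn
    exact ⟨δ, hδ, fun Ψ hE hpos => hΨ Ψ hE hpos⟩
  · -- large scales: compare with the partition at resolution `ℓ₀`
    obtain ⟨C, hev⟩ := Hℓ ℓ₀ hℓ₀ le_rfl
    refine ⟨216 * max C 0, ?_⟩
    filter_upwards [hev, ((tendsto_sideLength_atTop hρ).comp (tendsto_add_atTop_nat 1)).eventually_ge_atTop
      ℓ] with n hn hLn
    obtain ⟨δ, hδ, hΨ⟩ := hn
    refine ⟨δ, hδ, fun Ψ hE hpos => ?_⟩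
    have hLℓ : ℓ ≤ sideLength ρ (n + 1) := hLn
    have hL : 0 < sideLength ρ (n + 1) := hℓ.trans_le hLℓ
    dsimp only
    have hM : 0 < ⌊sideLength ρ (n + 1) / ℓ⌋₊ :=
      Nat.floor_pos.2 ((one_le_div hℓ).2 hLℓ)
    have hMm : ⌊sideLength ρ (n + 1) / ℓ⌋₊ ≤ ⌊sideLength ρ (n + 1) / ℓ₀⌋₊ :=
      Nat.floor_le_floor (div_le_div_of_nonneg_left hL.le hℓ₀ hgt.le)
    have hfine := hΨ Ψ hE hpos
    have hm3 : ((⌊sideLength ρ (n + 1) / ℓ₀⌋₊ : ℕ) : ℝ≥0∞) ^ 3 ≠ ⊤ :=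
      ENNReal.pow_ne_top (ENNReal.natCast_ne_top _)
    have hM3 : ((⌊sideLength ρ (n + 1) / ℓ⌋₊ : ℕ) : ℝ≥0∞) ^ 3 ≠ ⊤ :=
      ENNReal.pow_ne_top (ENNReal.natCast_ne_top _)
    rw [← lintegral_const_mul' _ _ hM3]
    rw [← lintegral_const_mul' _ _ hm3] at hfine
    calc ∫⁻ X : Fin n → EuclideanSpace ℝ (Fin 3), ((⌊sideLength ρ (n + 1) / ℓ⌋₊ : ℕ) : ℝ≥0∞) ^ 3 *
          ((∑ k : Fin 3 → Fin ⌊sideLength ρ (n + 1) / ℓ⌋₊,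
              (∫⁻ y in {y : EuclideanSpace ℝ (Fin 3) | ∀ i, y i ∈
                  Set.Ico ((k i : ℝ) * (sideLength ρ (n + 1) / ⌊sideLength ρ (n + 1) / ℓ⌋₊))
                    (((k i : ℝ) + 1) * (sideLength ρ (n + 1) / ⌊sideLength ρ (n + 1) / ℓ⌋₊))},
                (‖Ψ.ψ (Matrix.vecCons y X)‖₊ : ℝ≥0∞) ^ 2) ^ 2) /
            (∫⁻ y, (‖Ψ.ψ (Matrix.vecCons y X)‖₊ : ℝ≥0∞) ^ 2))
        ≤ ∫⁻ X : Fin n → EuclideanSpace ℝ (Fin 3), 216 *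
            (((⌊sideLength ρ (n + 1) / ℓ₀⌋₊ : ℕ) : ℝ≥0∞) ^ 3 *
              ((∑ k : Fin 3 → Fin ⌊sideLength ρ (n + 1) / ℓ₀⌋₊,
                  (∫⁻ y in {y : EuclideanSpace ℝ (Fin 3) | ∀ i, y i ∈
                      Set.Ico ((k i : ℝ) * (sideLength ρ (n + 1) / ⌊sideLength ρ (n + 1) / ℓ₀⌋₊))
                        (((k i : ℝ) + 1) * (sideLength ρ (n + 1) / ⌊sideLength ρ (n + 1) / ℓ₀⌋₊))},
                    (‖Ψ.ψ (Matrix.vecCons y X)‖₊ : ℝ≥0∞) ^ 2) ^ 2) /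
                (∫⁻ y, (‖Ψ.ψ (Matrix.vecCons y X)‖₊ : ℝ≥0∞) ^ 2))) :=
          lintegral_mono fun X => stub_partitionComparison hL hM hMm _ _
      _ = 216 * ∫⁻ X : Fin n → EuclideanSpace ℝ (Fin 3),
            (((⌊sideLength ρ (n + 1) / ℓ₀⌋₊ : ℕ) : ℝ≥0∞) ^ 3 *
              ((∑ k : Fin 3 → Fin ⌊sideLength ρ (n + 1) / ℓ₀⌋₊,
                  (∫⁻ y in {y : EuclideanSpace ℝ (Fin 3) | ∀ i, y i ∈
                      Set.Ico ((k i : ℝ) * (sideLength ρ (n + 1) / ⌊sideLength ρ (n + 1) / ℓ₀⌋₊))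
                        (((k i : ℝ) + 1) * (sideLength ρ (n + 1) / ⌊sideLength ρ (n + 1) / ℓ₀⌋₊))},
                    (‖Ψ.ψ (Matrix.vecCons y X)‖₊ : ℝ≥0∞) ^ 2) ^ 2) /
                (∫⁻ y, (‖Ψ.ψ (Matrix.vecCons y X)‖₊ : ℝ≥0∞) ^ 2))) :=
          lintegral_const_mul' _ _ (by norm_num)
      _ ≤ 216 * ENNReal.ofReal C := by gcongr
      _ ≤ 216 * ENNReal.ofReal (max C 0) := by gcongr; exact le_max_left _ _
      _ = ENNReal.ofReal (216 * max C 0) := by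
          rw [ENNReal.ofReal_mul (by norm_num), ENNReal.ofReal_ofNat]

end Summit.AtomisticToContinuum.BoseEinsteinCondensation.Theorems.CoarseGrainedReverseHolder

end
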